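import Mathlib
import HarnessLib
import Summits.HubbardSuperconductivity.HubbardSuperconductivity.Theorems.WeakCouplingBCSKlCertTPrimeConvexChannelStates

/-!
# Route `WeakCouplingBCS` — certificate half of stmt-HubbardSuperconductivity-0158, item «CONVEX-WINDOW-ANALYTIC», file 2:
# THE ANALYTIC SCAN ROWS — `KLTPAnalytic (squareDispersion 1 t′) μ` on the WHOLE bracket of every KL-MARGIN-SCAN row `t′ ∈ {−0.3, −0.2, −0.1}`

Cell `gate-hubbard-kl`, seat p4 (g25); zero kit; no definitions.  Register corollaries of ✓ `kltp_analytic_Mside'` / ✓ `kltp_analytic_farGamma`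
(`…KlCertTPrimeConvexChannelStates`, file 1): the analytic twins of the Hilbert–Schmidt scan rows ✓ `kltp_HS_row_tpm03/02/01`, ✓ `kltp_HS_farGamma_row_tpm01`
(`…KlCertTPrimeConvexHSChart`, p4 g24 S3), by `norm_num` window checks only:

* `kltp_analytic_row_tpm03` — `t′ = −0.3`, M side, every `μ ∈ (−6/5, 0)` (⊃ the brackets of the cells `δ ∈ {0.05, …, 0.25}`, in particular the `(⅛, −0.3)` records' box
  `[−1, −9/10]`: `kltp_analytic_box_m03`);
* `kltp_analytic_row_tpm02` — `t′ = −0.2`, M side, every `μ ∈ (−4/5, 0)`;  `kltp_analytic_row_tpm01` — `t′ = −0.1`, M side, every `μ ∈ (−2/5, 0)`;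
* `kltp_analytic_farGamma_row_tpm01` — `t′ = −0.1`, far-Γ side, every `μ ∈ (−18/5, −98/125)` (cells `δ ∈ {0.275, …, 0.35}`).

So on every scan row the bundled analytic hypothesis of the certificate soundness chain is a theorem on the whole bracket; a record on such a row is conditional on its
certified enclosures ONLY.  HONEST LABEL: no record is created or decided here (KIT FREEZE); RECORD ≠ DECIDED; nothing about `K₃`, `U₀`, the doping window or
superconductivity; a Kohn–Luttinger `O(U²)` channel statement is not ODLRO; nothing here proves superconductivity in the Hubbard model.
References: S. Raghu, S. A. Kivelson, D. J. Scalapino, Phys. Rev. B 81 (2010) 224505, §II (5)–(8), §III Fig. 3.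
-/

noncomputable section

-- the tree's namespace `Summit.<Summit>.<Problem>.Theorems` repeats the summit name by design (D-0017)
set_option linter.dupNamespace false

namespace Summit.HubbardSuperconductivity.HubbardSuperconductivity.Theorems

open Set Real Literature.MathematicalPhysics.QuantumLattice KlTPrimeConvexity

/-- Scan row `t′ = −0.3`, M side: `KLTPAnalytic` at every level `μ ∈ (−6/5, 0)`. [cite: RaghuKivelsonScalapino2010, §II (5)-(8)] -/
theorem kltp_analytic_row_tpm03 {μ : ℝ} (hμ : μ ∈ Set.Ioo (-6 / 5 : ℝ) 0) : KLTPAnalytic (squareDispersion 1 (-3 / 10)) μ := by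
  obtain ⟨h1, h2⟩ := hμ
  have hdisc : μ - 4 * (-3 / 10 : ℝ) < 32 * |(-3 / 10 : ℝ)| * (1 - 4 * (-3 / 10 : ℝ) ^ 2) := by
    rw [abs_of_neg (by norm_num)]; nlinarith
  exact kltp_analytic_Mside' (by norm_num) (by norm_num) (by linarith) (by linarith) hdisc

/-- The `(⅛, −0.3)` records' box `μ ∈ [−1, −9/10]`: `KLTPAnalytic (squareDispersion 1 (−3/10)) μ` with no hypothesis. [cite: RaghuKivelsonScalapino2010, §II (5)-(8)] -/
theorem kltp_analytic_box_m03 {μ : ℝ} (hμ1 : -1 ≤ μ) (hμ2 : μ ≤ -9 / 10) : KLTPAnalytic (squareDispersion 1 (-3 / 10)) μ :=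
  kltp_analytic_row_tpm03 ⟨by linarith, by linarith⟩

/-- Scan row `t′ = −0.2`, M side: `KLTPAnalytic` at every level `μ ∈ (−4/5, 0)`. [cite: RaghuKivelsonScalapino2010, §II (5)-(8)] -/
theorem kltp_analytic_row_tpm02 {μ : ℝ} (hμ : μ ∈ Set.Ioo (-4 / 5 : ℝ) 0) : KLTPAnalytic (squareDispersion 1 (-2 / 10)) μ := by
  obtain ⟨h1, h2⟩ := hμ
  have hdisc : μ - 4 * (-2 / 10 : ℝ) < 32 * |(-2 / 10 : ℝ)| * (1 - 4 * (-2 / 10 : ℝ) ^ 2) := by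
    rw [abs_of_neg (by norm_num)]; nlinarith
  exact kltp_analytic_Mside' (by norm_num) (by norm_num) (by linarith) (by linarith) hdisc

/-- Scan row `t′ = −0.1`, M side: `KLTPAnalytic` at every level `μ ∈ (−2/5, 0)`. [cite: RaghuKivelsonScalapino2010, §II (5)-(8)] -/
theorem kltp_analytic_row_tpm01 {μ : ℝ} (hμ : μ ∈ Set.Ioo (-2 / 5 : ℝ) 0) : KLTPAnalytic (squareDispersion 1 (-1 / 10)) μ := by
  obtain ⟨h1, h2⟩ := hμ
  have hdisc : μ - 4 * (-1 / 10 : ℝ) < 32 * |(-1 / 10 : ℝ)| * (1 - 4 * (-1 / 10 : ℝ) ^ 2) := by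
    rw [abs_of_neg (by norm_num)]; nlinarith
  exact kltp_analytic_Mside' (by norm_num) (by norm_num) (by linarith) (by linarith) hdisc

/-- Scan row `t′ = −0.1`, far-Γ side: `KLTPAnalytic` at every level `μ ∈ (−18/5, −98/125)` (cells `δ ∈ {0.275, …, 0.35}`). [cite: RaghuKivelsonScalapino2010, §II (5)-(8)] -/
theorem kltp_analytic_farGamma_row_tpm01 {μ : ℝ} (hμ : μ ∈ Set.Ioo (-18 / 5 : ℝ) (-98 / 125)) :
    KLTPAnalytic (squareDispersion 1 (-1 / 10)) μ := by
  obtain ⟨h1, h2⟩ := hμ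
  have hμc : μ < convexityReturnLevel (-1 / 10) := by rw [convexityReturnLevel_m01]; linarith
  exact kltp_analytic_farGamma (by norm_num) (by norm_num) (by linarith) hμc

/-- **The analytic scan chart at `t′ = −0.1`**: both arms — far-Γ `μ ∈ (−18/5, −98/125)` and M side `μ ∈ (−2/5, 0)` — carry `KLTPAnalytic` with no hypothesis.
[cite: RaghuKivelsonScalapino2010, §II (5)-(8)] -/
theorem kltp_analytic_rows_tpm01 {μ : ℝ} (hμ : μ ∈ Set.Ioo (-18 / 5 : ℝ) (-98 / 125) ∨ μ ∈ Set.Ioo (-2 / 5 : ℝ) 0) :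
    KLTPAnalytic (squareDispersion 1 (-1 / 10)) μ :=
  hμ.elim kltp_analytic_farGamma_row_tpm01 kltp_analytic_row_tpm01

end Summit.HubbardSuperconductivity.HubbardSuperconductivity.Theorems

end
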